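import Summits.ABC.IUTFork.Joshi.TestThetaValuesLocusModel
import Summits.ABC.IUTFork.Joshi.PrimitiveAnsatzPointsClassical
import HarnessLib

/-!
# A kernel MODEL of `EtaPtTeich` over E-t3's model carriers: the hypothesis «`η_{K_{y_a}}([a]) = p`» of
# `Joshi/MochizukiAnsatzLocal` is SATISFIABLE jointly with the whole `PeriodRingDatum`/`PrototypeDatum` signature — and the
# degree-one locus `classicalPts` of `Joshi/PrimitiveAnsatzPointsClassical` is a PROPER, NONEMPTY sub-locus there

Test-side support file of the abc-iut cell, branch E (rung LADDER-ABC:A2.E; seat abc-iut-E-t2, gen 2 — AUTHORS-FIRST non-vacuity duty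
for my own named hypotheses over abc-iut-E-t3's signature, E-plan-2 2026-08-26T08:22:53Z; companion of E-t3's vacuity model
`Joshi/TestThetaValuesLocusModel.lean`, whose toolkit is imported BY NAME: `Model.expo`, `Model.cfun`, `Model.lift`,
`Model.periodRingDatum`, `Model.prototypeDatum`, `Model.absOne`). NOTHING here is a claim about Joshi's or Mochizuki's mathematics;
no side is taken; it shows only that typed hypotheses are jointly satisfiable / where they fail.

WHY. After the author's refutation of the whole-type hypothesis `PtSurjective` (`PeriodRingDatum.not_ptSurjective`), the one named
hypothesis of my [J-IIp] §6 files that remains in use is `PeriodRingDatum.EtaPtTeich` (Lem. 6.10.1 / [FF18, Déf. 2.2.1]: at the point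
`y_a` of `[a] − p`, `η_{K_{y_a}}([a]) = p`, for `0 ≠ a ∈ 𝔪_F`). E-t3's model (`Y := Q̄_p`, `pt := id`, `η_a` = evaluation at `a`,
Teichmüller map `x ↦ (a ↦ x·c_a(‖x‖))` a sphere-wise rescaling by CHOSEN constants) does not decide it. THE MODEL HERE changes one
field: the Teichmüller/untilt map at an admissible point `a` is E-t3's `lift a` followed by the TRANSPOSITION of the two values
`lift a a = a·c` and `p` (both on the sphere `‖·‖ = ‖p‖ = ‖a‖^{1/e_a}`; their `lift a`-preimages are `a` and `p/c`): `swapLift a a := p`,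
`swapLift a (p/c) := a·c`, `swapLift a x := lift a x` otherwise. The norm identity `‖swapLift a x‖ = ‖x‖^{1/e_a}` (so axioms (A1)
`|η_y([x])|_{K_y} = |x|_F` and `|[x]|_ρ = |x|_F`) and the surjectivity (A2) survive the transposition, and NOW `η_{y_a}([a]) =
swapLift a a = p` holds BY CONSTRUCTION: `EtaPtTeich` is TRUE in the model (`etaPtTeich_model`). All other fields are E-t3's.

ALSO RECORDED (the locus reading of `Joshi/PrimitiveAnsatzPointsClassical` is contentful): in the model `classicalPts = {0 < ‖y‖ < 1}`
(`classicalPts_model`), which contains `p` and misses `1` and `0` — a proper nonempty sub-locus of the carrier type; the repaired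
Lem. 6.2.2 statements are NOT vacuous (`lem622_model`: an explicit tuple through `y = p`), and the `EtaPtTeich`-consequences of
`Joshi/PrimitiveAnsatzPoints` hold with a TRUE antecedent (`eta_pt_primElt_model`). [folklore]
-/

noncomputable section

open Set

namespace Summit.ABC.IUTFork.Joshi.Model

open PadicAlgCl

variable (p : ℕ) [hp : Fact p.Prime]

/-! ## 0. Local `p`-adic bookkeeping (private copies; the same facts are private in E-t3's files) -/

/-- `0 < ‖p‖ < 1` in `Q̄_p`. [folklore] -/
private theorem norm_p_pos_lt_one'' : 0 < ‖(p : PadicAlgCl p)‖ ∧ ‖(p : PadicAlgCl p)‖ < 1 := by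
  have h1 : (1 : ℝ) < p := by exact_mod_cast hp.out.one_lt
  have hn : ‖(p : PadicAlgCl p)‖ = (p : ℝ)⁻¹ := by
    rw [← map_natCast (algebraMap ℚ_[p] (PadicAlgCl p)), ← PadicAlgCl.coe_eq]
    show ‖((p : ℚ_[p]) : PadicAlgCl p)‖ = _
    rw [PadicAlgCl.norm_extends, Padic.norm_p]
  rw [hn]
  exact ⟨inv_pos.2 (lt_trans one_pos h1), inv_lt_one_of_one_lt₀ h1⟩

/-- `(p : Q̄_p) ≠ 0`. [folklore] -/
private theorem p_ne_zero'' : (p : PadicAlgCl p) ≠ 0 := norm_pos_iff.1 (norm_p_pos_lt_one'' p).1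

/-- Admissibility of a parameter in the model: `0 < ‖a‖ < 1`. [folklore] -/
def Adm (a : PadicAlgCl p) : Prop := 0 < ‖a‖ ∧ ‖a‖ < 1

/-- For admissible `a`: `‖p‖ = ‖a‖^{1/e_a}` (from E-t3's `‖p‖^{e_a} = ‖a‖`). [folklore] -/
theorem norm_p_eq_rpow_inv_expo {a : PadicAlgCl p} (ha : Adm p a) : ‖(p : PadicAlgCl p)‖ = ‖a‖ ^ (1 / expo p a) := by
  rw [← norm_p_rpow_expo p ha.1 ha.2, ← Real.rpow_mul (norm_nonneg _), mul_one_div_cancel (expo_pos p a).ne', Real.rpow_one]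

/-- The rescaling constant at the parameter's own radius, `c := c_a(‖a‖)`. [folklore] -/
def cst (a : PadicAlgCl p) : PadicAlgCl p := cfun p a ‖a‖

/-- For admissible `a`: `c ≠ 0` and `‖c‖ = ‖a‖^{1/e_a − 1}`. [folklore] -/
theorem cst_spec {a : PadicAlgCl p} (ha : Adm p a) : cst p a ≠ 0 ∧ ‖cst p a‖ = ‖a‖ ^ (1 / expo p a - 1) :=
  cfun_spec p a (norm_pos_iff.1 ha.1)

/-- `lift a a = a · c`. [folklore] -/
theorem lift_self (a : PadicAlgCl p) : lift p a a = a * cst p a := rfl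

/-- For admissible `a`: `‖p / c‖ = ‖a‖` — the second swapped point lies on the sphere of `a`. [folklore] -/
theorem norm_p_div_cst {a : PadicAlgCl p} (ha : Adm p a) : ‖(p : PadicAlgCl p) / cst p a‖ = ‖a‖ := by
  rw [norm_div, (cst_spec p ha).2, norm_p_eq_rpow_inv_expo p ha, ← Real.rpow_sub ha.1]
  have : 1 / expo p a - (1 / expo p a - 1) = 1 := by ring
  rw [this, Real.rpow_one]

/-- For admissible `a`: `lift a (p / c) = p` (the `lift a`-preimage of `p` on the sphere of `a` is `p/c`). [folklore] -/
theorem lift_p_div_cst {a : PadicAlgCl p} (ha : Adm p a) : lift p a ((p : PadicAlgCl p) / cst p a) = p := by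
  unfold lift
  rw [norm_p_div_cst p ha]
  exact div_mul_cancel₀ _ (cst_spec p ha).1

/-! ## 1. The transposed Teichmüller map `swapLift` and its two axioms -/

open scoped Classical in
/-- **The model Teichmüller/untilt map at the point `a`**: E-t3's `lift a` with the values at `a` and at `p/c` TRANSPOSED when `a` is
admissible (`a ↦ p`, `p/c ↦ a·c`), unchanged otherwise. [folklore] -/
def swapLift (a x : PadicAlgCl p) : PadicAlgCl p :=
  if Adm p a then (if x = a then (p : PadicAlgCl p) else if x = (p : PadicAlgCl p) / cst p a then lift p a a else lift p a x)
  else lift p a x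

/-- `swapLift a a = p` for admissible `a` — the point of the construction. [folklore] -/
theorem swapLift_self {a : PadicAlgCl p} (ha : Adm p a) : swapLift p a a = p := by
  unfold swapLift; rw [if_pos ha, if_pos rfl]

/-- Off the admissible parameters `swapLift a = lift a`. [folklore] -/
theorem swapLift_of_not_adm {a : PadicAlgCl p} (ha : ¬ Adm p a) (x : PadicAlgCl p) : swapLift p a x = lift p a x := by
  unfold swapLift; rw [if_neg ha]

/-- **Norm identity**: `‖swapLift a x‖ = ‖x‖^{1/e_a}` in every branch (both transposed values lie on the right sphere). [folklore] -/
theorem norm_swapLift (a x : PadicAlgCl p) : ‖swapLift p a x‖ = ‖x‖ ^ (1 / expo p a) := by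
  unfold swapLift
  split_ifs with ha hx hx'
  · rw [hx]; exact norm_p_eq_rpow_inv_expo p ha
  · rw [norm_lift, hx', norm_p_div_cst p ha]
  · exact norm_lift p a x
  · exact norm_lift p a x

/-- Axiom (A1) for the transposed map: `‖swapLift a x‖^{e_a} = ‖x‖`. [folklore] -/
theorem norm_swapLift_rpow (a x : PadicAlgCl p) : ‖swapLift p a x‖ ^ expo p a = ‖x‖ := by
  rw [norm_swapLift, ← Real.rpow_mul (norm_nonneg x), one_div_mul_cancel (expo_pos p a).ne', Real.rpow_one]

/-- Axiom (A2) for the transposed map: `swapLift a` is onto (a transposition after E-t3's onto `lift a`). [folklore] -/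
theorem swapLift_surjective (a ξ : PadicAlgCl p) : ∃ x : PadicAlgCl p, swapLift p a x = ξ := by
  by_cases ha : Adm p a
  · by_cases h1 : ξ = p
    · exact ⟨a, by rw [swapLift_self p ha, h1]⟩
    by_cases h2 : ξ = lift p a a
    · refine ⟨(p : PadicAlgCl p) / cst p a, ?_⟩
      unfold swapLift
      rw [if_pos ha]
      by_cases h3 : (p : PadicAlgCl p) / cst p a = a
      · -- then `a·c = p`, both transposed values coincide
        have hac := div_mul_cancel₀ (p : PadicAlgCl p) (cst_spec p ha).1
        rw [h3] at hac
        rw [if_pos h3, h2, lift_self]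
        exact hac.symm
      · rw [if_neg h3, if_pos rfl, h2]
    · obtain ⟨x, hx⟩ := lift_surjective p a ξ
      refine ⟨x, ?_⟩
      unfold swapLift
      rw [if_pos ha]
      have hxa : x ≠ a := fun h => h2 (by rw [← hx, h])
      have hxp : x ≠ (p : PadicAlgCl p) / cst p a := fun h => h1 (by rw [← hx, h, lift_p_div_cst p ha])
      rw [if_neg hxa, if_neg hxp, hx]
  · obtain ⟨x, hx⟩ := lift_surjective p a ξ
    exact ⟨x, by rw [swapLift_of_not_adm p ha, hx]⟩

/-! ## 2. The model datum: E-t3's `periodRingDatum` / `prototypeDatum` with the transposed Teichmüller map -/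

/-- **The model period-ring datum with `η_{y_a}([a]) = p`**: all fields are E-t3's (`Model.periodRingDatum`) except the Teichmüller map
`x ↦ (a ↦ swapLift a x)` and the three axioms that mention it. [folklore] -/
def periodRingDatumEta : PeriodRingDatum (PadicAlgCl p) (PadicAlgCl p → PadicAlgCl p) (PadicAlgCl p) (PadicAlgCl p)
    (fun _ => PadicAlgCl p) Unit :=
  { periodRingDatum p with
    teich := fun x a => swapLift p a x
    norm_teich := fun ρ x _ _ => by
      show ‖swapLift p (p : PadicAlgCl p) x‖ = absOne p x
      rw [absOne_apply, norm_swapLift, expo_p, div_one, Real.rpow_one]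
    absK_eta_teich := fun a x => by
      show ‖swapLift p a x‖ ^ expo p a = ‖x‖ ^ (1 : ℝ)
      rw [Real.rpow_one]; exact norm_swapLift_rpow p a x
    exists_teich_lift := fun a ξ _ => swapLift_surjective p a ξ }

/-- **The model prototype datum** (`ℓ⋆ = 2`, `q_E := p^{10}`, `ξ := p`, as in E-t3's model) over `periodRingDatumEta`. [folklore] -/
def prototypeDatumEta : PrototypeDatum (PadicAlgCl p) (PadicAlgCl p → PadicAlgCl p) (PadicAlgCl p) (PadicAlgCl p)
    (fun _ => PadicAlgCl p) Unit :=
  { prototypeDatum p with toPeriodRingDatum := periodRingDatumEta p }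

/-- The model's point map is the identity (E-t3's choice, unchanged). [folklore] -/
theorem pt_eq (a : PadicAlgCl p) : (prototypeDatumEta p).pt a = a := rfl

/-- The model's `|−|_F` is the norm. [folklore] -/
theorem absF_eq (a : PadicAlgCl p) : (prototypeDatumEta p).absF a = ‖a‖ := absOne_apply p a

/-! ## 3. `EtaPtTeich` HOLDS in the model; the locus is proper and nonempty; Lem. 6.2.2 (repaired) is not vacuous -/

/-- **NON-VACUITY of `EtaPtTeich`**: in the model, `η_{K_{y_a}}([a]) = p` for every `0 ≠ a` with `|a|_F < 1` — jointly with ALL axioms of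
E-t3's `PeriodRingDatum`/`PrototypeDatum`. [folklore] -/
theorem etaPtTeich_model : (prototypeDatumEta p).EtaPtTeich := by
  intro a ha0 ha
  have hadm : Adm p a := ⟨norm_pos_iff.2 ha0, by rwa [absF_eq] at ha⟩
  show swapLift p a a = ((periodRingDatum p).p : PadicAlgCl p)
  rw [swapLift_self p hadm]
  rfl

/-- Hence the `EtaPtTeich`-consequences of `Joshi/PrimitiveAnsatzPoints` hold in the model with a TRUE antecedent, e.g. `η_{y_a}([a] − p) = 0`.
[folklore] -/
theorem eta_pt_primElt_model {a : PadicAlgCl p} (ha0 : a ≠ 0) (ha : ‖a‖ < 1) :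
    (prototypeDatumEta p).eta ((prototypeDatumEta p).pt a) ((prototypeDatumEta p).primElt a) = 0 :=
  (prototypeDatumEta p).eta_pt_primElt (etaPtTeich_model p) ha0 (by rwa [absF_eq])

/-- **The degree-one locus in the model** is the punctured open unit ball `{0 < ‖y‖ < 1}` (`pt = id`). [folklore] -/
theorem classicalPts_model : (prototypeDatumEta p).classicalPts = {y : PadicAlgCl p | 0 < ‖y‖ ∧ ‖y‖ < 1} := by
  ext y
  constructor
  · rintro ⟨a, ha0, ha, rfl⟩
    exact ⟨norm_pos_iff.2 ha0, by rwa [absF_eq] at ha⟩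
  · rintro ⟨h0, h1⟩
    exact ⟨y, norm_pos_iff.1 h0, by rwa [absF_eq], rfl⟩

/-- The locus is NONEMPTY (`p` lies in it) … [folklore] -/
theorem p_mem_classicalPts_model : (p : PadicAlgCl p) ∈ (prototypeDatumEta p).classicalPts := by
  rw [classicalPts_model]; exact norm_p_pos_lt_one'' p

/-- … and PROPER: `1` (= the junk value `pt 1`, φ-fixed) is not in it — the concrete face of `not_ptSurjective`. [folklore] -/
theorem one_not_mem_classicalPts_model : (1 : PadicAlgCl p) ∉ (prototypeDatumEta p).classicalPts := by
  rw [classicalPts_model]; simp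

/-- So `classicalPts ≠ univ` in the model: the typed hypothesis `PtSurjective` is false HERE by an explicit witness (it is false in
EVERY datum by `not_ptSurjective`). [folklore] -/
theorem classicalPts_model_ne_univ : (prototypeDatumEta p).classicalPts ≠ Set.univ := fun h =>
  one_not_mem_classicalPts_model p (by rw [h]; exact Set.mem_univ _)

/-- **Lem. 6.2.2 (repaired form) is NOT vacuous**: at the classical point `y = p` of the model the tuple of `Σ̃_F` through it EXISTS —
the instance of `exists_tuple_first_eq_of_mem` with a TRUE antecedent. [folklore] -/
theorem lem622_model : ∃ t ∈ (prototypeDatumEta p).primitiveAnsatz, t (prototypeDatumEta p).firstIdx = (p : PadicAlgCl p) :=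
  (prototypeDatumEta p).exists_tuple_first_eq_of_mem (p_mem_classicalPts_model p)

/-- The model's Ansatz tuple of `p` consists of the `ℓ⋆ = 2` DISTINCT points `p`, `p⁴` (`ansatzPt_injective` instantiated). [folklore] -/
theorem ansatzPt_model_injective : Function.Injective ((prototypeDatumEta p).ansatzPt (p : PadicAlgCl p)) :=
  (prototypeDatumEta p).ansatzPt_injective ⟨p_ne_zero'' p, by rw [absF_eq]; exact (norm_p_pos_lt_one'' p).2⟩

/-- **NON-VACUITY, packaged** (over `Q̄_2`): a prototype datum in which `EtaPtTeich` holds, the degree-one locus is a proper nonempty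
subset of the point type, and `PtSurjective` fails. [folklore] -/
theorem etaPtTeich_satisfiable :
    ∃ (P : PrototypeDatum (PadicAlgCl 2) (PadicAlgCl 2 → PadicAlgCl 2) (PadicAlgCl 2) (PadicAlgCl 2) (fun _ => PadicAlgCl 2) Unit),
      P.EtaPtTeich ∧ P.classicalPts.Nonempty ∧ P.classicalPts ≠ Set.univ ∧ ¬ P.PtSurjective :=
  haveI : Fact (Nat.Prime 2) := ⟨Nat.prime_two⟩
  ⟨prototypeDatumEta 2, etaPtTeich_model 2, ⟨_, p_mem_classicalPts_model 2⟩, classicalPts_model_ne_univ 2,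
    (prototypeDatumEta 2).not_ptSurjective⟩

end Summit.ABC.IUTFork.Joshi.Model

end
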